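import Summits.BirchSwinnertonDyer.BirchSwinnertonDyer.Theorems.SchneiderFreeAdditiveX3EndStateControlDischarged
import Summits.BirchSwinnertonDyer.BirchSwinnertonDyer.Theorems.SchneiderFreeAdditiveX3GordCellRowPrimes
import Summits.BirchSwinnertonDyer.BirchSwinnertonDyer.Theorems.SchneiderFreeAdditiveX3PotMultCellRowPrimes
import HarnessLib

/-!
# Route `SchneiderFreeAdditiveX3` (K1 door): the RUNG LEAF `SchneiderFree.AdditiveX3RankOneLower` needs the two branch cruxes ONLY at
# `p ∈ {3, 5, 7, 13}` (r2, (M)) and `p ∈ {3, 5, 7, 13, 37}` (r3, (G-ord, `e = 2`)) — nine instance families — besides `PrintedFacts` and Mazur's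
# two isogeny theorems (displayed)

Cell `bsd-schneider-ideate`, seat `bsd-schneider-door-c5` (prover, generation 35; assembly layer; `--supports` 19177).  PARTITION: board row
B6 ∩ X3 ∩ sst-twist, `r = 1` (7 101 census pairs: 4 541 (M) + 2 560 (G-ord, `e = 2`), all at `p ∈ {3, 5, 7, 13}`; class-wide) of
`Rank1Residual.partition` — ASSEMBLY; types-the-object-of nothing new; closes nothing (BSD NOT advanced).  bears_on: K1-door (rung K1 leaf
`SchneiderFree.AdditiveX3RankOneLower` ⇐ `PrintedFacts` ∧ r2 `PotMultBranchIMC` (19176) ∧ r3 `GordTwoBranchIMC` (19177), generation 20's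
`additiveX3RankOneLower_of_printedFacts_of_branchIMCs` with the control crux discharged).

WHAT.  Generation 35 showed both cruxes VACUOUS off the census primes (Mazur's Thm. 1 and `j`-table, displayed):
`KYBranchRowPrimesPotMult.potMultBranchIMC_of_rowPrimes` (r2 = its instances at `p ∈ {3, 5, 7, 13}`) and
`KYBranchRowPrimes.gordTwoBranchIMC_of_rowPrimes` (r3 = its instances at `p ∈ {3, 5, 7, 13, 37}`).  Composing with generation 20's leaf theorem:
**`additiveX3RankOneLower_of_printedFacts_of_rowPrimes`** — the rung leaf (lower half `ord_p #Ш_an ≤ ord_p #Ш` on the whole additive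
semistable-twist class X3 ∩ sst, `r_an = 1`, every odd `p`) from `PrintedFacts`, Mazur's two theorems, and the two cruxes' OWN instances at those
nine (cell, prime) families, stated in their currency `AdditiveIMCLowerBDPInputManinAt W p`.

HONEST FRAMING: a composition of tree theorems, CONDITIONAL on every displayed hypothesis (`PrintedFacts` = thirteen published facts; Mazur's
theorems as named published facts; the nine instance families are exactly what items 19176/19177 still owe — OPEN); no definition, no new named
fact, no `sorry`; nothing is closed; BSD is proved for no curve; «closes rung: none».
References: Mazur, Invent. Math. 44 (1978) Thm. 1, Thm. 7.1, table p. 129 [Mazur1978]; Darmon 2004 Thm. 3.22 [Darmon2004]; Jetchev–Skinner–Wan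
2017 §7.4.1 [JetchevSkinnerWan2017]; this seat p739034 (F24d), p739345 (F24e); generation 20 (`…EndStateControlDischarged`).
-/

set_option autoImplicit false
-- `Summit.<P>.<Sub>` repeats `BirchSwinnertonDyer` by the tree's layout convention (D-0017)
set_option linter.dupNamespace false

noncomputable section

open scoped Classical

open WeierstrassCurve Literature.NumberTheory.EllipticCurves Literature.NumberTheory.EllipticCurves.Rank1Residual
  Summit.BirchSwinnertonDyer.Rank1Residual Summit.BirchSwinnertonDyer.BirchSwinnertonDyer.Theorems.SchneiderFree
  Summit.BirchSwinnertonDyer.BirchSwinnertonDyer.Theses.SchneiderFreeAdditiveX3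

namespace Summit.BirchSwinnertonDyer.BirchSwinnertonDyer.Theorems.SchneiderFreeAdditiveX3.KYBranchLeafRowPrimes

/-- **The K1 rung leaf from `PrintedFacts`, Mazur's two isogeny theorems, and the two branch cruxes' OWN instances at the census primes** —
r2 (`PotMultBranchIMC`, the (M) cell) at `p ∈ {3, 5, 7, 13}` and r3 (`GordTwoBranchIMC`, the (G-ord, `e = 2`) cell) at `p ∈ {3, 5, 7, 13, 37}`,
in their currency `AdditiveIMCLowerBDPInputManinAt W p`: both cruxes are vacuous at every other prime (generation 35's
`potMultBranchIMC_of_rowPrimes`, `gordTwoBranchIMC_of_rowPrimes`), and the leaf follows by generation 20's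
`additiveX3RankOneLower_of_printedFacts_of_branchIMCs`.  CONDITIONAL on all displayed hypotheses; nothing is closed; BSD is NOT advanced.
[cite: Mazur1978, Thm. 1 and table p. 129] [cite: Darmon2004, Thm. 3.22 and §3.9] [cite: JetchevSkinnerWan2017, §7.4.1 (arXiv:1512.06894 p. 30)] -/
theorem additiveX3RankOneLower_of_printedFacts_of_rowPrimes (hF : PrintedFacts) (hM : mazur_isogeny_irreducible)
    (hJ : mazur_j_mem_of_not_hasIrreducibleModPGaloisRep_of_eleven_le)
    (h2 : ∀ (W : WeierstrassCurve ℚ) [W.IsElliptic] [W.IsGloballyMinimal] (p : ℕ) [Fact p.Prime],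
      p = 3 ∨ p = 5 ∨ p = 7 ∨ p = 13 → W.analyticRank = 1 → ClassX3 W p → Additive.SubM W p → AdditiveIMCLowerBDPInputManinAt W p)
    (h3 : ∀ (W : WeierstrassCurve ℚ) [W.IsElliptic] [W.IsGloballyMinimal] (p : ℕ) [Fact p.Prime],
      p = 3 ∨ p = 5 ∨ p = 7 ∨ p = 13 ∨ p = 37 → W.analyticRank = 1 → ClassX3 W p → Additive.SubGordTwo W p →
        AdditiveIMCLowerBDPInputManinAt W p) :
    AdditiveX3RankOneLower :=
  ControlDischarged.additiveX3RankOneLower_of_printedFacts_of_branchIMCs hF (KYBranchRowPrimesPotMult.potMultBranchIMC_of_rowPrimes hM hJ h2)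
    (KYBranchRowPrimes.gordTwoBranchIMC_of_rowPrimes hM hJ h3)

end Summit.BirchSwinnertonDyer.BirchSwinnertonDyer.Theorems.SchneiderFreeAdditiveX3.KYBranchLeafRowPrimes

end
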